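import Mathlib

/-!
# T5SphericalSection — a `K`-fixed section of an induced representation is determined by its
value at `1` (Tier-5 sub-step N4.2 / §G, row B1)

Row B1 of route/T5-route-3.md (l. 23) reads: «the unramified `Φ_v = Φ⁰` is the Siegel–Weil
section of the unramified Schwartz function `φ⁰` …: `Φ_{φ⁰}(g) := (ω(g)φ⁰)(0)` is `K_v`-fixed
with value `1` at `g = 1`, hence equals the normalised spherical section [A, from the
definitions; requires the unramified splitting data, `p ≠ 2`]».  The «hence» is the following
elementary fact about induced representations, recorded here for the kernel:

* a **section** (`IsSection P K ξ Φ`) is a function `Φ : G → ℂ` with `Φ(p g) = ξ(p) Φ(g)` for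
  `p ∈ P` (left `(P, ξ)`-equivariance — the defining property of a vector of the induced
  representation `Ind_P^G ξ`, with `ξ` the inducing character, e.g. `χ δ_P^{s + ρ}`) and
  `Φ(g k) = Φ(g)` for `k ∈ K` (right `K`-invariance — «`K`-fixed»);
* under the **Iwasawa decomposition** `G = P K` (`IsIwasawa P K`), a section is determined by
  its value at `1` (`eq_of_apply_one_eq`): `Φ(p k) = ξ(p) Φ(1)`;
* if the inducing character is **trivial on `P ∩ K`** (the unramified condition), the
  normalised spherical section `Φ⁰(p k) := ξ(p)` is well defined (`sphericalSection`), is a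
  section (`isSection_sphericalSection`) with `Φ⁰(1) = 1` (`sphericalSection_one`), every
  section is `Φ(1) · Φ⁰` (`eq_smul_sphericalSection`), and a `K`-fixed section with value `1`
  at `1` IS `Φ⁰` (`eq_sphericalSection_of_apply_one`) — the row's «hence».

What stays prose (the row's [A]): that `g ↦ (ω(g)φ⁰)(0)` is a section of the degenerate
principal series in question (Rallis / Kudla's Siegel–Weil map), that it is `K_v`-fixed for the
unramified data, and the Iwasawa decomposition of the unitary group at `v`.  No Literature fact
is asserted.
-/

namespace Summit.Ventures.HodgeRepro2.T5SphericalSection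

variable {G : Type*} [Group G]

/-- `G = P K`: every `g` is a product `p k` with `p ∈ P`, `k ∈ K`. -/
def IsIwasawa (P K : Subgroup G) : Prop := ∀ g : G, ∃ p ∈ P, ∃ k ∈ K, g = p * k

/-- A `(P, ξ)`-equivariant, right `K`-invariant function: a `K`-fixed vector of the induced
representation `Ind_P^G ξ` (the inducing character `ξ` is only used on `P`). -/
structure IsSection (P K : Subgroup G) (ξ : G → ℂ) (Φ : G → ℂ) : Prop where
  /-- Left equivariance under `P` through `ξ`. -/
  left : ∀ p ∈ P, ∀ g, Φ (p * g) = ξ p * Φ g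
  /-- Right invariance under `K`. -/
  right : ∀ k ∈ K, ∀ g, Φ (g * k) = Φ g

section Determined

variable {P K : Subgroup G} {ξ : G → ℂ} {Φ Φ' : G → ℂ}

/-- A section takes the value `ξ(p) Φ(1)` at `g = p k`. -/
theorem IsSection.apply_mul (hΦ : IsSection P K ξ Φ) {p k : G} (hp : p ∈ P) (hk : k ∈ K) :
    Φ (p * k) = ξ p * Φ 1 := by
  have h1 := hΦ.right k hk 1
  rw [one_mul] at h1
  rw [hΦ.left p hp, h1]

/-- Under `G = P K`, every value of a section is `ξ(p) Φ(1)` for some `p ∈ P`. -/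
theorem IsSection.exists_apply_eq (hPK : IsIwasawa P K) (hΦ : IsSection P K ξ Φ) (g : G) :
    ∃ p ∈ P, Φ g = ξ p * Φ 1 := by
  obtain ⟨p, hp, k, hk, rfl⟩ := hPK g
  exact ⟨p, hp, hΦ.apply_mul hp hk⟩

/-- **A `K`-fixed section is determined by its value at `1`** (under `G = P K`). -/
theorem eq_of_apply_one_eq (hPK : IsIwasawa P K) (hΦ : IsSection P K ξ Φ)
    (hΦ' : IsSection P K ξ Φ') (h : Φ 1 = Φ' 1) : Φ = Φ' := by
  funext g
  obtain ⟨p, hp, k, hk, rfl⟩ := hPK g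
  rw [hΦ.apply_mul hp hk, hΦ'.apply_mul hp hk, h]

/-- A section vanishing at `1` vanishes identically. -/
theorem IsSection.eq_zero_of_apply_one_eq_zero (hPK : IsIwasawa P K) (hΦ : IsSection P K ξ Φ)
    (h : Φ 1 = 0) : Φ = 0 := by
  funext g
  obtain ⟨p, hp, Φg⟩ := hΦ.exists_apply_eq hPK g
  simp [Φg, h]

/-- Every section is `Φ(1) · Φ₀` for any section `Φ₀` with `Φ₀(1) = 1`. -/
theorem IsSection.eq_smul (hPK : IsIwasawa P K) (hΦ : IsSection P K ξ Φ)
    (hΦ₀ : IsSection P K ξ Φ') (h₀ : Φ' 1 = 1) : Φ = Φ 1 • Φ' := by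
  funext g
  obtain ⟨p, hp, k, hk, rfl⟩ := hPK g
  rw [Pi.smul_apply, smul_eq_mul, hΦ.apply_mul hp hk, hΦ₀.apply_mul hp hk, h₀, mul_one,
    mul_comm]

/-- Sections form a `ℂ`-subspace: sums and scalar multiples of sections are sections. -/
theorem IsSection.add (hΦ : IsSection P K ξ Φ) (hΦ' : IsSection P K ξ Φ') :
    IsSection P K ξ (Φ + Φ') where
  left p hp g := by simp [hΦ.left p hp g, hΦ'.left p hp g, mul_add]
  right k hk g := by simp [hΦ.right k hk g, hΦ'.right k hk g]

/-- Scalar multiples of sections are sections. -/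
theorem IsSection.smul (hΦ : IsSection P K ξ Φ) (c : ℂ) : IsSection P K ξ (c • Φ) where
  left p hp g := by simp [hΦ.left p hp g, mul_left_comm]
  right k hk g := by simp [hΦ.right k hk g]

end Determined

/-! ## The normalised spherical section `Φ⁰(p k) = ξ(p)` -/

section Spherical

variable (P K : Subgroup G) (ξ : G →* ℂ)

/-- Well-definedness of `p k ↦ ξ(p)`: if `ξ` is trivial on `P ∩ K` and `p k = p' k'`, then
`ξ(p) = ξ(p')`. -/
theorem apply_eq_of_mul_eq (hξ : ∀ x ∈ P, x ∈ K → ξ x = 1) {p k p' k' : G}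
    (hp : p ∈ P) (hk : k ∈ K) (hp' : p' ∈ P) (hk' : k' ∈ K) (h : p * k = p' * k') :
    ξ p = ξ p' := by
  have hx : p'⁻¹ * p = k' * k⁻¹ := by
    calc p'⁻¹ * p = p'⁻¹ * (p * k) * k⁻¹ := by group
      _ = p'⁻¹ * (p' * k') * k⁻¹ := by rw [h]
      _ = k' * k⁻¹ := by group
  have hxP : p'⁻¹ * p ∈ P := P.mul_mem (P.inv_mem hp') hp
  have hxK : p'⁻¹ * p ∈ K := by rw [hx]; exact K.mul_mem hk' (K.inv_mem hk)
  have h1 : ξ (p'⁻¹ * p) = 1 := hξ _ hxP hxK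
  rw [map_mul, map_inv] at h1
  have hp'0 : ξ p' ≠ 0 := by
    intro h0
    rw [h0, inv_zero, zero_mul] at h1
    exact zero_ne_one h1
  calc ξ p = ξ p' * ((ξ p')⁻¹ * ξ p) := by rw [← mul_assoc, mul_inv_cancel₀ hp'0, one_mul]
    _ = ξ p' := by rw [h1, mul_one]

variable (hPK : IsIwasawa P K)

/-- The normalised spherical section: `Φ⁰(g) := ξ(p)` for a chosen decomposition `g = p k`. -/
noncomputable def sphericalSection (g : G) : ℂ := ξ (Classical.choose (hPK g))

/-- `Φ⁰(p k) = ξ(p)` for EVERY decomposition, when `ξ` is trivial on `P ∩ K`. -/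
theorem sphericalSection_mul (hξ : ∀ x ∈ P, x ∈ K → ξ x = 1) {p k : G} (hp : p ∈ P)
    (hk : k ∈ K) : sphericalSection P K ξ hPK (p * k) = ξ p := by
  unfold sphericalSection
  obtain ⟨hp', k', hk', hg⟩ := Classical.choose_spec (hPK (p * k))
  exact apply_eq_of_mul_eq P K ξ hξ hp' hk' hp hk hg.symm

/-- `Φ⁰(1) = 1`. -/
theorem sphericalSection_one (hξ : ∀ x ∈ P, x ∈ K → ξ x = 1) :
    sphericalSection P K ξ hPK 1 = 1 := by
  have := sphericalSection_mul P K ξ hPK hξ P.one_mem K.one_mem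
  rwa [mul_one, map_one] at this

/-- `Φ⁰` is a `K`-fixed section of `Ind_P^G ξ`. -/
theorem isSection_sphericalSection (hξ : ∀ x ∈ P, x ∈ K → ξ x = 1) :
    IsSection P K (⇑ξ) (sphericalSection P K ξ hPK) where
  left p hp g := by
    obtain ⟨q, hq, k, hk, rfl⟩ := hPK g
    rw [← mul_assoc, sphericalSection_mul P K ξ hPK hξ (P.mul_mem hp hq) hk,
      sphericalSection_mul P K ξ hPK hξ hq hk, map_mul]
  right k hk g := by
    obtain ⟨q, hq, k', hk', rfl⟩ := hPK g
    rw [mul_assoc, sphericalSection_mul P K ξ hPK hξ hq (K.mul_mem hk' hk),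
      sphericalSection_mul P K ξ hPK hξ hq hk']

/-- **Every `K`-fixed section is `Φ(1) · Φ⁰`.** -/
theorem eq_smul_sphericalSection (hξ : ∀ x ∈ P, x ∈ K → ξ x = 1) {Φ : G → ℂ}
    (hΦ : IsSection P K (⇑ξ) Φ) : Φ = Φ 1 • sphericalSection P K ξ hPK :=
  hΦ.eq_smul hPK (isSection_sphericalSection P K ξ hPK hξ) (sphericalSection_one P K ξ hPK hξ)

/-- **Row B1's «hence»:** a `K`-fixed section with value `1` at `g = 1` IS the normalised
spherical section. -/
theorem eq_sphericalSection_of_apply_one (hξ : ∀ x ∈ P, x ∈ K → ξ x = 1) {Φ : G → ℂ}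
    (hΦ : IsSection P K (⇑ξ) Φ) (h : Φ 1 = 1) : Φ = sphericalSection P K ξ hPK := by
  rw [eq_smul_sphericalSection P K ξ hPK hξ hΦ, h, one_smul]

/-- The `K`-fixed sections are exactly the multiples of `Φ⁰`. -/
theorem isSection_iff_exists_smul (hξ : ∀ x ∈ P, x ∈ K → ξ x = 1) (Φ : G → ℂ) :
    IsSection P K (⇑ξ) Φ ↔ ∃ c : ℂ, Φ = c • sphericalSection P K ξ hPK := by
  constructor
  · intro hΦ
    exact ⟨Φ 1, eq_smul_sphericalSection P K ξ hPK hξ hΦ⟩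
  · rintro ⟨c, rfl⟩
    exact (isSection_sphericalSection P K ξ hPK hξ).smul c

end Spherical

end Summit.Ventures.HodgeRepro2.T5SphericalSection
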